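import Summits.PneNP.PneNP.Theorems.LatticeMagicTargetStubGameBricks
import Literature.Computability.Cryptography.OneWayFunctions

/-!
# `stub_game`, part 3/4: the bricks replay the simulated game; the PPT predictors `A_{j₀}`

Card `kpt-squeeze-ideal-lattice-leg`, §First lemma: on a well-formed input `⟨⟨1ⁿ, g x⟩, r⟩` the bricks
of part 2 compute the history, the proposals and the answer of the simulated play on the instance
assembled from the coin blocks with `x` planted at `j₀` (`entriesF_inst`, `propF_inst`, `scanF_inst`);
the predictor `adv` as a `RandAlg`, its polynomial time (`adv_isPPT`) and `run_eq_simAnswer`.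

## References

* O. Goldreich, *Foundations of Cryptography I*, CUP 2001, §1.3.2, §2.5.2.
* S. Arora, B. Barak, *Computational Complexity: A Modern Approach*, CUP 2009, §1.3, §7.1.
-/

set_option linter.dupNamespace false -- `Summit.PneNP.PneNP` is the mandated summit-side namespace

namespace Summit.PneNP.PneNP.Theorems.LatticeMagicTarget

open Literature.Computability.Complexity Literature.Computability.Cryptography
open _root_.Computability

namespace StubGame

variable {t : ℕ} (g : List Bool → List Bool) (B : List Bool → Bool) (S : List Bool → List Bool)

/-! ### 4. The bricks compute the simulated play; the predictors `A_{j₀}` -/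

section Machine

open Literature.Computability.Complexity.Brick

variable {g B S} {Bb : List Bool → List Bool}

/-- The candidate coordinates as naturals. -/
def candN (t : ℕ) (j₀ : Fin t) : List ℕ := (cand t j₀).map Fin.val

/-- The instance assembled by the predictor from the coins `r`: block `j` of `r` at `j ≠ j₀`, the
(unknown) challenge preimage `x` at `j₀`. -/
def inst (t : ℕ) (j₀ : Fin t) (x r : List Bool) (n : ℕ) : HBInstance t :=
  ⟨fun j => if j = j₀ then x else chunk n r j⟩

/-- Off the planted coordinate the assembled instance holds the coin blocks. -/
theorem inst_u_of_ne {j₀ j : Fin t} (h : j ≠ j₀) (x r : List Bool) (n : ℕ) :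
    (inst t j₀ x r n).u j = chunk n r j := if_neg h

/-- At the planted coordinate the assembled instance holds the challenge preimage. -/
theorem inst_u_self (j₀ : Fin t) (x r : List Bool) (n : ℕ) : (inst t j₀ x r n).u j₀ = x := if_pos rfl

/-- Candidates are not the planted coordinate. -/
theorem ne_of_mem_cand {j₀ j : Fin t} (h : j ∈ cand t j₀) : j ≠ j₀ := by
  simpa [cand] using h

variable (g) in
/-- The images brick shows the images of the assembled instance (the planted image is the input `g x`). -/
theorem imgsF_inst (j₀ : Fin t) (x r : List Bool) (n : ℕ) :
    imgsF g t j₀ (zIn n (g x) r) = flat (List.ofFn fun j => g ((inst t j₀ x r n).u j)) := by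
  rw [imgsF_zIn]
  refine congrArg flat (congrArg List.ofFn (funext fun j => ?_))
  by_cases h : j = j₀
  · subst h; simp [inst]
  · rw [inst_u_of_ne h, if_neg (fun h' => h (Fin.ext h'))]

variable (g S) in
/-- **The bricks replay the simulated game**: the entries computed in the first `rr` rounds are the
encoded history of `S` against the simulated teacher on the assembled instance. -/
theorem entriesF_inst (hBb : ∀ w, Bb w = [B w]) {j₀ d : Fin t} (hd : d ≠ j₀) (x r : List Bool) (n : ℕ)
    (rr : ℕ) : (entriesF S Bb (candN t j₀) d (imgsF g t j₀) rr).map (fun f => f (zIn n (g x) r)) =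
      (hbHist g S (simT B (inst t j₀ x r n) j₀ d) (inst t j₀ x r n) rr).map
        (fun p => boolPair (unaryEncodeNat p.1) p.2) := by
  induction rr with
  | zero => rfl
  | succ rr ih =>
    have hview : fanoutFn (imgsF g t j₀) (flatF (entriesF S Bb (candN t j₀) d (imgsF g t j₀) rr))
        (zIn n (g x) r) = hbView g (inst t j₀ x r n)
          (hbHist g S (simT B (inst t j₀ x r n) j₀ d) (inst t j₀ x r n) rr) := by
      rw [fanoutFn_apply, flatF_apply, ih, imgsF_inst, hbView]
    have hV : (S ∘ fanoutFn (imgsF g t j₀) (flatF (entriesF S Bb (candN t j₀) d (imgsF g t j₀) rr)))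
        (zIn n (g x) r) = S (hbView g (inst t j₀ x r n)
          (hbHist g S (simT B (inst t j₀ x r n) j₀ d) (inst t j₀ x r n) rr)) := by
      rw [Function.comp_apply, hview]
    rw [entriesF.eq_2, hbHist.eq_2]
    simp only [List.map_append, List.map_cons, List.map_nil]
    rw [ih, List.append_cancel_left_eq, List.singleton_inj, selF_zIn n (g x) r hBb, entryF_zIn]
    simp only [hV]
    -- the selected coordinate, as a natural, is the simulated teacher's choice
    have hsel : ∀ v : List Bool,
        firstSat (fun i : ℕ => B (chunk n r i) ≠ v.getD i false) (candN t j₀) (d : ℕ) =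
          ((firstSat (Wrong B (inst t j₀ x r n) v ·) (cand t j₀) d : Fin t) : ℕ) := by
      intro v
      rw [candN]
      refine firstSat_map _ _ Fin.val (fun a ha => ?_) d
      rw [Wrong, inst_u_of_ne (ne_of_mem_cand ha)]
    have hj : ∀ v : List Bool, firstSat (Wrong B (inst t j₀ x r n) v ·) (cand t j₀) d ≠ j₀ := by
      intro v
      rcases firstSat_mem_or (Wrong B (inst t j₀ x r n) v ·) (l := cand t j₀) d with h | h
      · exact ne_of_mem_cand h
      · rw [h]; exact hd
    rw [hsel, simT, inst_u_of_ne (hj _)]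

variable (g S) in
/-- The proposal bricks compute the proposals of the simulated play. -/
theorem propF_inst (hBb : ∀ w, Bb w = [B w]) {j₀ d : Fin t} (hd : d ≠ j₀) (x r : List Bool)
    (n rr : ℕ) :
    propF S Bb (candN t j₀) d (imgsF g t j₀) rr (zIn n (g x) r) =
      hbProposal g S (simT B (inst t j₀ x r n) j₀ d) (inst t j₀ x r n) rr := by
  rw [propF, Function.comp_apply, fanoutFn_apply, flatF_apply, entriesF_inst g S hBb hd x r n rr,
    imgsF_inst, hbProposal, hbView]

variable (g S) in
/-- The answer brick computes `simAnswer`'s scan. -/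
theorem scanF_inst (hBb : ∀ w, Bb w = [B w]) {j₀ d : Fin t} (hd : d ≠ j₀) (x r : List Bool) (n : ℕ) :
    ∀ m s, scanF S Bb (candN t j₀) d (imgsF g t j₀) j₀ s m (zIn n (g x) r) =
      [scanOut
        (fun r' => decide (∀ i ∈ cand t j₀,
          ¬ Wrong B (inst t j₀ x r n) (hbProposal g S (simT B (inst t j₀ x r n) j₀ d) (inst t j₀ x r n) r') i))
        (fun r' => (hbProposal g S (simT B (inst t j₀ x r n) j₀ d) (inst t j₀ x r n) r').getD j₀ false)
        s m]
  | 0, _ => rfl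
  | m + 1, s => by
    have hP := propF_inst g S hBb hd x r n s
    have hiff : (∀ i ∈ candN t j₀, ¬ (B (chunk n r i) ≠
        (propF S Bb (candN t j₀) d (imgsF g t j₀) s (zIn n (g x) r)).getD i false)) ↔
        ∀ i ∈ cand t j₀, ¬ Wrong B (inst t j₀ x r n)
          (hbProposal g S (simT B (inst t j₀ x r n) j₀ d) (inst t j₀ x r n) s) i := by
      rw [hP]
      simp only [candN, List.forall_mem_map]
      refine forall₂_congr fun a ha => ?_
      rw [Wrong, inst_u_of_ne (ne_of_mem_cand ha)]
    simp only [scanF, scanOut]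
    rw [iteFn_apply (allRightF_zIn n (g x) r hBb _ _)]
    by_cases hc : ∀ i ∈ cand t j₀, ¬ Wrong B (inst t j₀ x r n)
        (hbProposal g S (simT B (inst t j₀ x r n) j₀ d) (inst t j₀ x r n) s) i
    · rw [decide_eq_true (hiff.2 hc), if_pos rfl, decide_eq_true hc, if_pos rfl, bitAtF_apply, hP]
    · rw [decide_eq_false (fun h => hc (hiff.1 h)), if_neg Bool.false_ne_true, decide_eq_false hc,
        if_neg Bool.false_ne_true, scanF_inst hBb hd x r n m (s + 1)]

variable (g S Bb)

/-- The output brick of the predictor `A_{j₀}` (`k` rounds, `t` coordinates, default `d`). -/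
noncomputable def advOut (k t : ℕ) (j₀ d : Fin t) : List Bool → List Bool :=
  scanF S Bb (candN t j₀) d (imgsF g t j₀) j₀ 0 k

/-- **The predictor `A_{j₀}`** for the hard-core bit: run the output brick on `⟨input, coins⟩` and
read the answer bit; `t ℓ` coins on inputs of length `ℓ`. -/
noncomputable def adv (k t : ℕ) (j₀ d : Fin t) : RandAlg (List Bool) Bool where
  run inp r := decide (advOut g S Bb k t j₀ d (boolPair inp r) = [true])
  coinLen ℓ := t * ℓ

variable {g S Bb}

/-- The output brick is in `FP`. -/
theorem advOut_mem_FP (hg : g ∈ FP) (hS : S ∈ FP) (hBb : Bb ∈ FP) (k t : ℕ) (j₀ d : Fin t) :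
    advOut g S Bb k t j₀ d ∈ FP :=
  scanF_mem_FP hS hBb (imgsF_mem_FP hg t j₀) j₀ k 0

/-- The output brick outputs one bit. -/
theorem oneBit_advOut (k t : ℕ) (j₀ d : Fin t) : OneBit (advOut g S Bb k t j₀ d) :=
  oneBit_scanF _ _ _ _ k 0

/-- The encoded answer of `A_{j₀}` is the output brick's value. -/
theorem encodeBool_run (k t : ℕ) (j₀ d : Fin t) (inp r : List Bool) :
    encodeBool ((adv g S Bb k t j₀ d).run inp r) = advOut g S Bb k t j₀ d (boolPair inp r) := by
  obtain ⟨b, hb⟩ := oneBit_advOut (g := g) (S := S) (Bb := Bb) k t j₀ d (boolPair inp r)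
  show [decide (advOut g S Bb k t j₀ d (boolPair inp r) = [true])] = _
  rw [hb]
  cases b <;> simp

/-- **`A_{j₀}` is PPT** for `g, S, B` polynomial-time. -/
theorem adv_isPPT (hg : g ∈ FP) (hS : S ∈ FP) (hBb : Bb ∈ FP) (k t : ℕ) (j₀ d : Fin t) :
    IsPPT (adv g S Bb k t j₀ d) encodeBool := by
  refine ⟨?_, Polynomial.C t * Polynomial.X, fun ℓ => by simp [adv]⟩
  obtain ⟨p, M, hM⟩ := advOut_mem_FP hg hS hBb k t j₀ d
  refine ⟨p, M, fun q => ?_⟩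
  obtain ⟨inp, r⟩ := q
  show M.OutputsWithin (boolPair inp r) (encodeBool ((adv g S Bb k t j₀ d).run inp r))
    (p.eval (boolPair inp r).length)
  rw [encodeBool_run]
  exact hM _

/-- **The run of `A_{j₀}` on an honest input is the simulated play's answer.** -/
theorem run_eq_simAnswer (hBb : ∀ w, Bb w = [B w]) (k : ℕ) {j₀ d : Fin t} (hd : d ≠ j₀)
    (x r : List Bool) (n : ℕ) :
    (adv g S Bb k t j₀ d).run (boolPair (unaryEncodeNat n) (g x)) r =
      simAnswer g B S k (inst t j₀ x r n) j₀ d := by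
  show decide (advOut g S Bb k t j₀ d (zIn n (g x) r) = [true]) = _
  rw [advOut, scanF_inst g S hBb hd x r n k 0, simAnswer]
  simp

end Machine

end StubGame

/-- **The planted-coordinate predictor is PPT** (explicit-binder form, registered sub-goal
`stubGame_adv_isPPT` of stmt-PneNP-10709): with `g`, the student `S` and the bit-brick `Bb` in `FP`, the
predictor `A_{j₀}` is a probabilistic polynomial-time algorithm. -/
theorem stubGame_adv_isPPT (g S Bb : List Bool → List Bool) (hg : g ∈ FP) (hS : S ∈ FP) (hBb : Bb ∈ FP)
    (k t : ℕ) (j₀ d : Fin t) : IsPPT (StubGame.adv g S Bb k t j₀ d) encodeBool :=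
  StubGame.adv_isPPT hg hS hBb k t j₀ d

end Summit.PneNP.PneNP.Theorems.LatticeMagicTarget
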